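import Literature.NumberTheory.CubicFields.ThreeTorsionParametrizationDiscriminant
import Literature.NumberTheory.CubicFields.ThreeTorsionParametrizationIdeal
import Literature.NumberTheory.QuadraticFields.IntegralBasisConjugation
import HarnessLib

/-!
# Surjectivity in Bhargava's parametrization: every pair `(I, δ)` with `I³ = (δ)` in a quadratic field comes from a form (HCL I, Thm 13; Bhargava–Varma, Thm 9)

Topic `Literature/NumberTheory/CubicFields`, continuing `ThreeTorsionParametrizationDiscriminant.lean`
(`disc(a)·N(θ₀) = A³D`), `…Uniqueness.lean` (`θ = θ(a)` or `−σθ(a)`), `…Ideal.lean` (`I(C)`)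
and `QuadraticFields/IntegralBasisConjugation.lean` (`𝓞 K = ℤ + ℤτ`, `σ`, norms). Ninth step of
the class-field-theory-free road to the Davenport–Heilbronn theorem on `Cl(K)[3]`
(Bhargava–Varma 2016, §§2–3).

Bhargava, HCL I, proof of Thm 13: "Given a triple `(S, I, δ)` … Let `S = ℤ + ℤτ` as before, and let
`I = ℤα + ℤβ` … we may write (21) `α³ = δ(c₀ + a₀τ)`, …, `β³ = δ(c₃ + a₃τ)` for some eight
integers `aᵢ` and `cᵢ`. Then `C(x, y) = a₀x³ + 3a₁x²y + 3a₂xy² + a₃y³` is our desired binary cubic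
form", together with (22) `Disc(C) = Disc(S)` and the uniqueness of the `cᵢ`. Here, for the
maximal order `S = 𝓞 K` of a quadratic field `K` (`[K : ℚ] = 2`, `D = d_K`, `s = √D`,
`T : TauData K`) and a nonzero ideal `I` with `I³ = (d)`:

* `exists_form_of_cube_eq_span` — **there is an integer-matrix form `C` with `disc C = d_K` whose
  pair `(I(C), δ(C))` is equivalent to `(I, d)`**: `(d) · I(C) = (y) · I` and `d³ δ(C) = y³ d` for
  some `y ≠ 0` (namely `y = ±αβ` for a suitable `ℤ`-basis `(α, β)` of `I`), with explicit integral
  representatives `u₁, u₂` of `θ₁(C), θ₂(C)`.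

Proof: take a `ℤ`-basis `(α, β)` of `I` (`TauData.exists_basis_of_ideal`), `uᵢ = (α³, α²β, αβ², β³)ᵢ/d ∈ 𝓞 K`,
`aᵢ = π(uᵢ)`; the `uᵢ` form a nondegenerate progression with `π`-parts `a`, and
`disc(a) = D` by `disc(a) N(u₀) = A³D` and `N(u₀) = A³` (from `N(d)² = N(I)⁶`, i.e. `I³ = (d)`, and
`A = N(α)N(I)²/N(d)`); by uniqueness `u = θ(a)` — done with `C = a`, `y = αβ` — or `u = −σθ(a)`,
in which case the basis `(α, −β)` gives `u' = θ(a ∘ diag(1,−1))` and `C = a ∘ diag(1,−1)`, `y = −αβ`.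
All statements are proved.

## References

* M. Bhargava, *Higher composition laws I*, Ann. of Math. 159 (2004), §3.4, Thm 13 and its proof,
  eqs. (21)–(23) [Bhargava2004HCL1].
* M. Bhargava, I. Varma, Proc. LMS 112 (2016) = arXiv:1401.5875, Thm 9 [BhargavaVarma2016].
-/

namespace Literature.NumberTheory.CubicFields

open NumberField Module
open scoped NumberField
open Literature.NumberTheory.QuadraticFields.Quadratic

namespace SymCubic

/-! ### An ideal identity -/

/-- `(x)(a, b) = (y)(c, e)` when `xa = yc` and `xb = ye`. [folklore] -/
theorem span_singleton_mul_span_pair_eq {R : Type*} [CommRing R] {x a b y c e : R}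
    (h1 : x * a = y * c) (h2 : x * b = y * e) :
    Ideal.span {x} * Ideal.span {a, b} = Ideal.span {y} * Ideal.span {c, e} := by
  apply le_antisymm
  · refine Ideal.mul_le.mpr fun p hp q hq => ?_
    rw [Ideal.mem_span_singleton] at hp
    obtain ⟨r, rfl⟩ := hp
    rw [Ideal.mem_span_pair] at hq
    obtain ⟨m, n, rfl⟩ := hq
    have : x * r * (m * a + n * b) = y * (r * (m * c + n * e)) := by
      linear_combination (r * m) * h1 + (r * n) * h2
    rw [this]
    exact Ideal.mul_mem_mul (Ideal.mem_span_singleton_self y)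
      (Ideal.mul_mem_left _ _ (Ideal.add_mem _ (Ideal.mul_mem_left _ _ (Ideal.subset_span (by simp)))
        (Ideal.mul_mem_left _ _ (Ideal.subset_span (by simp)))))
  · refine Ideal.mul_le.mpr fun p hp q hq => ?_
    rw [Ideal.mem_span_singleton] at hp
    obtain ⟨r, rfl⟩ := hp
    rw [Ideal.mem_span_pair] at hq
    obtain ⟨m, n, rfl⟩ := hq
    have : y * r * (m * c + n * e) = x * (r * (m * a + n * b)) := by
      linear_combination (-(r * m)) * h1 - (r * n) * h2
    rw [this]
    exact Ideal.mul_mem_mul (Ideal.mem_span_singleton_self x)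
      (Ideal.mul_mem_left _ _ (Ideal.add_mem _ (Ideal.mul_mem_left _ _ (Ideal.subset_span (by simp)))
        (Ideal.mul_mem_left _ _ (Ideal.subset_span (by simp)))))

/-! ### The conjugates of Bhargava's values -/

/-- `σ θᵢ(C) = (gᵢ − aᵢ s)/2` for a ring endomorphism `σ` with `σ s = −s`. [folklore] -/
theorem conj_thetaForm {K : Type*} [Field K] (C : SymCubic ℤ) (σ : K →+* K) {s : K}
    (hσ : σ s = -s) :
    σ (C.thetaForm s).a₀ = ((C.gCov.a₀ : K) - (C.a₀ : K) * s) / 2 ∧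
      σ (C.thetaForm s).a₁ = ((C.gCov.a₁ : K) - (C.a₁ : K) * s) / 2 ∧
      σ (C.thetaForm s).a₂ = ((C.gCov.a₂ : K) - (C.a₂ : K) * s) / 2 ∧
      σ (C.thetaForm s).a₃ = ((C.gCov.a₃ : K) - (C.a₃ : K) * s) / 2 := by
  simp only [thetaForm_a₀, thetaForm_a₁, thetaForm_a₂, thetaForm_a₃, map_div₀, map_add, map_mul,
    map_intCast, map_ofNat, hσ]
  refine ⟨?_, ?_, ?_, ?_⟩ <;> ring

/-- The values of `C ∘ diag(1, −1)`: `θ(C ∘ J) = (−σθ₀, σθ₁, −σθ₂, σθ₃)` (the cubic covariant has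
weight `3`, so it changes sign under `det = −1`). [folklore] -/
theorem thetaForm_subst_diag {K : Type*} [Field K] (C : SymCubic ℤ) (σ : K →+* K) {s : K}
    (hσ : σ s = -s) :
    ((C.subst !![1, 0; 0, -1]).thetaForm s).a₀ = -σ (C.thetaForm s).a₀ ∧
      ((C.subst !![1, 0; 0, -1]).thetaForm s).a₁ = σ (C.thetaForm s).a₁ ∧
      ((C.subst !![1, 0; 0, -1]).thetaForm s).a₂ = -σ (C.thetaForm s).a₂ ∧
      ((C.subst !![1, 0; 0, -1]).thetaForm s).a₃ = σ (C.thetaForm s).a₃ := by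
  obtain ⟨c0, c1, c2, c3⟩ := conj_thetaForm C σ hσ
  have hg := gCov_subst C !![1, 0; 0, -1]
  have hJ : Matrix.det !![(1 : ℤ), 0; 0, -1] = -1 := by rw [Matrix.det_fin_two_of]; norm_num
  rw [hJ] at hg
  have h00 : (!![(1 : ℤ), 0; 0, -1]) 0 0 = 1 := rfl
  have h01 : (!![(1 : ℤ), 0; 0, -1]) 0 1 = 0 := rfl
  have h10 : (!![(1 : ℤ), 0; 0, -1]) 1 0 = 0 := rfl
  have h11 : (!![(1 : ℤ), 0; 0, -1]) 1 1 = -1 := rfl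
  have k0 := congrArg SymCubic.a₀ hg
  have k1 := congrArg SymCubic.a₁ hg
  have k2 := congrArg SymCubic.a₂ hg
  have k3 := congrArg SymCubic.a₃ hg
  simp only [smul_a₀, smul_a₁, smul_a₂, smul_a₃, subst, h00, h01, h10, h11] at k0 k1 k2 k3
  rw [c0, c1, c2, c3]
  simp only [thetaForm_a₀, thetaForm_a₁, thetaForm_a₂, thetaForm_a₃, k0, k1, k2, k3, subst,
    h00, h01, h10, h11]
  push_cast
  refine ⟨?_, ?_, ?_, ?_⟩ <;> ring

/-! ### Surjectivity -/

section Surjective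

variable {K : Type*} [Field K] [NumberField K] (h2 : finrank ℚ K = 2) (T : TauData K)

omit [NumberField K] in
/-- The core of the surjectivity argument, for a `ℤ`-basis `(α, β)` of `I` whose cube values
`uᵢ = (α³, α²β, αβ², β³)ᵢ/d` ARE Bhargava's `θ(a)` (the positively oriented case): then
`(d) · I(a) = (αβ) · I` and `d³ · u₁u₂ = (αβ)³ d`. [folklore] -/
theorem pair_equiv_of_basis (a : SymCubic ℤ) {I : Ideal (𝓞 K)} {α β d u₁ u₂ : 𝓞 K}
    (hI : I = Ideal.span {α, β}) (hu₁ : d * u₁ = α ^ 2 * β) (hu₂ : d * u₂ = α * β ^ 2)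
    (ht₁ : (u₁ : K) = (a.thetaForm (T.s : K)).a₁) (ht₂ : (u₂ : K) = (a.thetaForm (T.s : K)).a₂) :
    Ideal.span {d} * a.cubicIdeal (T.s : K) = Ideal.span {α * β} * I ∧
      d ^ 3 * (u₁ * u₂) = (α * β) ^ 3 * d := by
  rw [cubicIdeal_eq_span a ht₁ ht₂, hI]
  refine ⟨span_singleton_mul_span_pair_eq (by rw [hu₁]; ring) (by rw [hu₂]; ring), ?_⟩
  linear_combination (d * (d * u₂)) * hu₁ + (d * α ^ 2 * β) * hu₂

/-- `(α, −β) = (α, β)` as ideals: Mathlib's `Ideal.span_pair_neg` (deprecated alias, dedup-01077). [folklore] -/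
@[deprecated (since := "2026-08-16")]
alias span_pair_neg_right := Ideal.span_pair_neg

include h2 in
/-- **Surjectivity** (HCL I Thm 13 / Bhargava–Varma Thm 9, for the maximal order of a quadratic
field): for every nonzero ideal `I` of `𝓞 K` and `d` with `I³ = (d)` there is an integer-matrix
form `C` of discriminant `d_K` whose pair is equivalent to `(I, d)`:
`(d) · I(C) = (y) · I`, `d³ · θ₁θ₂ = y³ · d` with `y ≠ 0` (and `d ≠ 0`), `θ₁θ₂ = δ(C)` through
integral representatives `u₁, u₂`. [cite: Bhargava2004HCL1, §3.4 (Theorem 13: every triple (S, I, δ) arises from a form, eqs. (21)–(23))] -/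
theorem exists_form_of_cube_eq_span (I : Ideal (𝓞 K)) (hI : I ≠ ⊥) (d : 𝓞 K)
    (hd : I ^ 3 = Ideal.span {d}) :
    ∃ (C : SymCubic ℤ) (u₁ u₂ y : 𝓞 K), C.disc = NumberField.discr K ∧
      (u₁ : K) = (C.thetaForm (T.s : K)).a₁ ∧ (u₂ : K) = (C.thetaForm (T.s : K)).a₂ ∧
      d ≠ 0 ∧ y ≠ 0 ∧
      Ideal.span {d} * C.cubicIdeal (T.s : K) = Ideal.span {y} * I ∧ d ^ 3 * (u₁ * u₂) = y ^ 3 * d := by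
  -- a basis of `I`, and basic facts
  obtain ⟨α, β, hα, hβ, hgen, hind, hidx⟩ := T.exists_basis_of_ideal h2 I hI
  have hs : (T.s : K) ^ 2 = (NumberField.discr K : K) := T.sq_s
  have hσs : T.σ h2 (T.s : K) = -(T.s : K) := T.σ_s h2
  have hDns : ¬ IsSquare (NumberField.discr K) := not_isSquare_discr h2
  have hs0 : (T.s : K) ≠ 0 := by
    intro h; apply hDns; refine ⟨0, ?_⟩
    have : ((NumberField.discr K : ℤ) : K) = 0 := by rw [← hs, h]; ring
    exact_mod_cast this
  have hd0 : d ≠ 0 := by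
    rintro rfl
    apply hI
    have : I ^ 3 = 0 := by rw [hd, Ideal.zero_eq_bot, Ideal.span_singleton_eq_bot]
    exact pow_eq_zero_iff (n := 3) (by norm_num) |>.mp this
  have hdK : (d : K) ≠ 0 := by exact_mod_cast hd0
  have hIspan : I = Ideal.span {α, β} := by
    apply le_antisymm
    · intro x hx
      obtain ⟨u, v, rfl⟩ := hgen x hx
      exact Ideal.add_mem _ (Ideal.mul_mem_left _ _ (Ideal.subset_span (by simp)))
        (Ideal.mul_mem_left _ _ (Ideal.subset_span (by simp)))
    · rw [Ideal.span_le]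
      rintro x (rfl | rfl)
      · exact hα
      · exact hβ
  have hα0 : α ≠ 0 := by
    intro h
    exact one_ne_zero (hind 1 0 (by rw [h]; simp)).1
  have hβ0 : β ≠ 0 := by
    intro h
    exact one_ne_zero (hind 0 1 (by rw [h]; simp)).2
  have hαK : (α : K) ≠ 0 := by exact_mod_cast hα0
  have hσαK : T.σ h2 (α : K) ≠ 0 := (map_ne_zero (T.σ h2)).mpr hαK
  -- the cube values `uᵢ`
  have mem3 : ∀ {x y z : 𝓞 K}, x ∈ I → y ∈ I → z ∈ I → x * y * z ∈ Ideal.span {d} := by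
    intro x y z hx hy hz
    rw [← hd, show (3 : ℕ) = 2 + 1 by rfl, pow_succ, pow_two]
    exact Ideal.mul_mem_mul (Ideal.mul_mem_mul hx hy) hz
  obtain ⟨u₀, hu₀⟩ := Ideal.mem_span_singleton'.mp (mem3 hα hα hα)
  obtain ⟨u₁, hu₁⟩ := Ideal.mem_span_singleton'.mp (mem3 hα hα hβ)
  obtain ⟨u₂, hu₂⟩ := Ideal.mem_span_singleton'.mp (mem3 hα hβ hβ)
  obtain ⟨u₃, hu₃⟩ := Ideal.mem_span_singleton'.mp (mem3 hβ hβ hβ)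
  have hu₁' : d * u₁ = α ^ 2 * β := by linear_combination hu₁
  have hu₂' : d * u₂ = α * β ^ 2 := by linear_combination hu₂
  -- in `K`
  have coe3 : ∀ {u p q r : 𝓞 K}, u * d = p * q * r → (d : K) * (u : K) = (p : K) * (q : K) * (r : K) := by
    intro u p q r h
    have := congrArg (algebraMap (𝓞 K) K) h
    simp only [map_mul] at this
    simp only [← RingOfIntegers.coe_eq_algebraMap] at this
    linear_combination this
  have e0 : (d : K) * (u₀ : K) = (α : K) ^ 3 := by rw [coe3 hu₀]; ring
  have e1 : (d : K) * (u₁ : K) = (α : K) ^ 2 * (β : K) := by rw [coe3 hu₁]; ring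
  have e2 : (d : K) * (u₂ : K) = (α : K) * (β : K) ^ 2 := by rw [coe3 hu₂]; ring
  have e3 : (d : K) * (u₃ : K) = (β : K) ^ 3 := by rw [coe3 hu₃]; ring
  -- the progression relations
  have h02 : (u₀ : K) * (u₂ : K) = (u₁ : K) ^ 2 := by
    have : (d : K) ^ 2 * ((u₀ : K) * (u₂ : K) - (u₁ : K) ^ 2) = 0 := by
      linear_combination ((d : K) * (u₂ : K)) * e0 + (α : K) ^ 3 * e2
        - ((d : K) * (u₁ : K) + (α : K) ^ 2 * (β : K)) * e1
    rcases mul_eq_zero.mp this with h | h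
    · exact absurd h (pow_ne_zero 2 hdK)
    · exact sub_eq_zero.mp h
  have h13 : (u₁ : K) * (u₃ : K) = (u₂ : K) ^ 2 := by
    have : (d : K) ^ 2 * ((u₁ : K) * (u₃ : K) - (u₂ : K) ^ 2) = 0 := by
      linear_combination ((d : K) * (u₃ : K)) * e1 + ((α : K) ^ 2 * (β : K)) * e3
        - ((d : K) * (u₂ : K) + (α : K) * (β : K) ^ 2) * e2
    rcases mul_eq_zero.mp this with h | h
    · exact absurd h (pow_ne_zero 2 hdK)
    · exact sub_eq_zero.mp h
  have h03 : (u₀ : K) * (u₃ : K) = (u₁ : K) * (u₂ : K) := by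
    have : (d : K) ^ 2 * ((u₀ : K) * (u₃ : K) - (u₁ : K) * (u₂ : K)) = 0 := by
      linear_combination ((d : K) * (u₃ : K)) * e0 + (α : K) ^ 3 * e3
        - ((d : K) * (u₂ : K)) * e1 - ((α : K) ^ 2 * (β : K)) * e2
    rcases mul_eq_zero.mp this with h | h
    · exact absurd h (pow_ne_zero 2 hdK)
    · exact sub_eq_zero.mp h
  -- the `π`-parts
  obtain ⟨c₀, a₀, hc₀⟩ := T.exists_int_coords u₀
  obtain ⟨c₁, a₁, hc₁⟩ := T.exists_int_coords u₁
  obtain ⟨c₂, a₂, hc₂⟩ := T.exists_int_coords u₂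
  obtain ⟨c₃, a₃, hc₃⟩ := T.exists_int_coords u₃
  have hτs : 2 * ((T.τ : 𝓞 K) : K) - (T.ε : K) = (T.s : K) := by rw [T.coe_τ]; ring
  have coeK : ∀ {u : 𝓞 K} {c e : ℤ}, u = (c : 𝓞 K) + (e : 𝓞 K) * T.τ →
      (u : K) = (c : K) + (e : K) * ((T.τ : 𝓞 K) : K) := by
    intro u c e h
    have := congrArg (algebraMap (𝓞 K) K) h
    simp only [map_add, map_mul, map_intCast] at this
    simp only [← RingOfIntegers.coe_eq_algebraMap] at this
    exact this
  have hπ : ∀ {u : 𝓞 K} {c e : ℤ}, u = (c : 𝓞 K) + (e : 𝓞 K) * T.τ →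
      (u : K) - T.σ h2 (u : K) = (e : K) * (T.s : K) := by
    intro u c e h
    rw [T.σ_coe_of_coords h2 h, coeK h, ← hτs]
    ring
  set a : SymCubic ℤ := ⟨a₀, a₁, a₂, a₃⟩ with ha_def
  have hπ₀ : (u₀ : K) - T.σ h2 (u₀ : K) = (a.a₀ : K) * (T.s : K) := hπ hc₀
  have hπ₁ : (u₁ : K) - T.σ h2 (u₁ : K) = (a.a₁ : K) * (T.s : K) := hπ hc₁
  have hπ₂ : (u₂ : K) - T.σ h2 (u₂ : K) = (a.a₂ : K) * (T.s : K) := hπ hc₂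
  have hπ₃ : (u₃ : K) - T.σ h2 (u₃ : K) = (a.a₃ : K) * (T.s : K) := hπ hc₃
  -- nondegeneracy
  have hNI : ((Ideal.absNorm I : ℕ) : K) ≠ 0 := by
    have : Ideal.absNorm I ≠ 0 := by rwa [Ne, Ideal.absNorm_eq_zero_iff]
    exact_mod_cast this
  have hν0 : (α : K) * T.σ h2 (β : K) - T.σ h2 (α : K) * (β : K) ≠ 0 := by
    rcases hidx with h | h
    · intro h0; rw [h0] at h; exact (mul_ne_zero hNI hs0) h
    · intro h0; rw [h0, neg_zero] at h; exact (mul_ne_zero hNI hs0) h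
  have hν2 : ((α : K) * T.σ h2 (β : K) - T.σ h2 (α : K) * (β : K)) ^ 2
      = ((Ideal.absNorm I : ℕ) : K) ^ 2 * (T.s : K) ^ 2 := by
    rcases hidx with h | h
    · rw [← h]; ring
    · rw [show (α : K) * T.σ h2 (β : K) - T.σ h2 (α : K) * (β : K)
        = -(((Ideal.absNorm I : ℕ) : K) * (T.s : K)) by rw [h]; ring]
      ring
  have hnd0 : (d : K) * T.σ h2 (d : K) ≠ 0 := mul_ne_zero hdK ((map_ne_zero _).mpr hdK)
  have hnα0 : (α : K) * T.σ h2 (α : K) ≠ 0 := mul_ne_zero hαK hσαK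
  have σe0 : T.σ h2 (d : K) * T.σ h2 (u₀ : K) = T.σ h2 (α : K) ^ 3 := by
    have := congrArg (T.σ h2) e0; simpa [map_mul, map_pow] using this
  have σe1 : T.σ h2 (d : K) * T.σ h2 (u₁ : K) = T.σ h2 (α : K) ^ 2 * T.σ h2 (β : K) := by
    have := congrArg (T.σ h2) e1; simpa [map_mul, map_pow] using this
  have hd01 : ((d : K) * T.σ h2 (d : K)) * ((u₀ : K) * T.σ h2 (u₁ : K) - T.σ h2 (u₀ : K) * (u₁ : K))
      = ((α : K) * T.σ h2 (α : K)) ^ 2 * ((α : K) * T.σ h2 (β : K) - T.σ h2 (α : K) * (β : K)) := by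
    linear_combination (T.σ h2 (d : K) * T.σ h2 (u₁ : K)) * e0 + (α : K) ^ 3 * σe1
      - ((d : K) * (u₁ : K)) * σe0 - T.σ h2 (α : K) ^ 3 * e1
  have hnd : (u₀ : K) * T.σ h2 (u₁ : K) ≠ T.σ h2 (u₀ : K) * (u₁ : K) := by
    intro h
    have : ((α : K) * T.σ h2 (α : K)) ^ 2 * ((α : K) * T.σ h2 (β : K) - T.σ h2 (α : K) * (β : K)) = 0 := by
      rw [← hd01, h, sub_self, mul_zero]
    exact (mul_ne_zero (pow_ne_zero 2 hnα0) hν0) this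
  -- `disc a = d_K`: norms
  have hN : (u₀ : K) * T.σ h2 (u₀ : K) * ((d : K) * T.σ h2 (d : K)) = ((α : K) * T.σ h2 (α : K)) ^ 3 := by
    linear_combination (T.σ h2 (d : K) * T.σ h2 (u₀ : K)) * e0 + (α : K) ^ 3 * σe0
  have hnorm : ((d : K) * T.σ h2 (d : K)) ^ 2 = ((Ideal.absNorm I : ℕ) : K) ^ 6 := by
    have h1 : ((Algebra.norm ℤ d : ℤ) : K) = (d : K) * T.σ h2 (d : K) := T.coe_norm h2 d
    have h2' : (Algebra.norm ℤ d).natAbs = Ideal.absNorm I ^ 3 := by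
      rw [← Ideal.absNorm_span_singleton, ← hd, map_pow]
    have h3 : (Algebra.norm ℤ d) ^ 2 = ((Ideal.absNorm I : ℕ) : ℤ) ^ 6 := by
      rw [← Int.natAbs_sq, h2']; push_cast; ring
    have h3K := congrArg (Int.cast (R := K)) h3
    push_cast at h3K
    rw [← h1, h3K]
  have hK1 := hess_A_mul_sq_mul_norm a (T.σ h2) h02 hπ₀ hπ₁ hπ₂
  have hA : (a.hess.1 : K) * ((d : K) * T.σ h2 (d : K))
      = ((α : K) * T.σ h2 (α : K)) * ((Ideal.absNorm I : ℕ) : K) ^ 2 := by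
    have : (T.s : K) ^ 2 * ((α : K) * T.σ h2 (α : K)) ^ 3 * ((a.hess.1 : K) * ((d : K) * T.σ h2 (d : K))
        - ((α : K) * T.σ h2 (α : K)) * ((Ideal.absNorm I : ℕ) : K) ^ 2) = 0 := by
      linear_combination ((α : K) * T.σ h2 (α : K)) ^ 4 * hν2
        + (((d : K) * T.σ h2 (d : K)) * ((u₀ : K) * T.σ h2 (u₁ : K) - T.σ h2 (u₀ : K) * (u₁ : K))
            + ((α : K) * T.σ h2 (α : K)) ^ 2 * ((α : K) * T.σ h2 (β : K) - T.σ h2 (α : K) * (β : K))) * hd01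
        + ((d : K) * T.σ h2 (d : K)) ^ 2 * hK1
        - ((a.hess.1 : K) * (T.s : K) ^ 2 * ((d : K) * T.σ h2 (d : K))) * hN
    rcases mul_eq_zero.mp this with h | h
    · exact absurd h (mul_ne_zero (pow_ne_zero 2 hs0) (pow_ne_zero 3 hnα0))
    · exact sub_eq_zero.mp h
  have hA3 : (a.hess.1 : K) ^ 3 = (u₀ : K) * T.σ h2 (u₀ : K) := by
    have : ((d : K) * T.σ h2 (d : K)) ^ 2 * ((a.hess.1 : K) ^ 3 * ((d : K) * T.σ h2 (d : K))
        - (u₀ : K) * T.σ h2 (u₀ : K) * ((d : K) * T.σ h2 (d : K))) = 0 := by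
      rw [hN]
      linear_combination ((a.hess.1 : K) ^ 2 * ((d : K) * T.σ h2 (d : K)) ^ 2
        + (a.hess.1 : K) * ((d : K) * T.σ h2 (d : K)) * ((α : K) * T.σ h2 (α : K)) * ((Ideal.absNorm I : ℕ) : K) ^ 2
        + ((α : K) * T.σ h2 (α : K)) ^ 2 * ((Ideal.absNorm I : ℕ) : K) ^ 4) * hA
        - ((α : K) * T.σ h2 (α : K)) ^ 3 * hnorm
    rcases mul_eq_zero.mp this with h | h
    · exact absurd h (pow_ne_zero 2 hnd0)
    · exact mul_right_cancel₀ hnd0 (sub_eq_zero.mp h)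
  have hdisc : (a.disc : K) = (NumberField.discr K : K) := by
    have h := disc_mul_norm_theta₀ a (T.σ h2) h02 h13 h03 hπ₀ hπ₁ hπ₂ hπ₃ hs0 hnd
    rw [← hA3, hs] at h
    have hA0 : (a.hess.1 : K) ^ 3 ≠ 0 := by
      rw [hA3]; exact (hess_A_ne_zero_of_nondeg a (T.σ h2) h02 hπ₀ hπ₁ hπ₂ hnd).2
    exact mul_right_cancel₀ hA0 (by linear_combination h)
  have hdiscZ : a.disc = NumberField.discr K := by exact_mod_cast hdisc
  have hs' : (T.s : K) ^ 2 = (a.disc : K) := by rw [hdisc]; exact hs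
  have hD' : ¬ IsSquare a.disc := by rw [hdiscZ]; exact hDns
  -- uniqueness: `u = θ(a)` or `u = −σθ(a)`
  rcases eq_thetaForm_or_eq_neg_conj a (T.σ h2) hσs hs' hD' h02 h13 h03 hπ₀ hπ₁ hπ₂ hπ₃ hnd with
    ⟨-, f1, f2, -⟩ | ⟨-, f1, f2, -⟩
  · -- positively oriented: `C = a`, `y = αβ`
    obtain ⟨hideal, hcube⟩ := pair_equiv_of_basis T a hIspan hu₁' hu₂' f1 f2
    exact ⟨a, u₁, u₂, α * β, hdiscZ, f1, f2, hd0, mul_ne_zero hα0 hβ0, hideal, hcube⟩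
  · -- negatively oriented: pass to the basis `(α, −β)` and `C = a ∘ diag(1, −1)`
    obtain ⟨-, g1, g2, -⟩ := thetaForm_subst_diag a (T.σ h2) (s := (T.s : K)) hσs
    set a' := a.subst !![1, 0; 0, -1] with ha'
    have f1' : ((-u₁ : 𝓞 K) : K) = (a'.thetaForm (T.s : K)).a₁ := by
      have : ((-u₁ : 𝓞 K) : K) = -(u₁ : K) := by simp
      rw [this, g1, f1, neg_neg]
    have f2' : (u₂ : K) = (a'.thetaForm (T.s : K)).a₂ := by rw [g2, f2]
    have hI' : I = Ideal.span {α, -β} := by rw [Ideal.span_pair_neg]; exact hIspan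
    obtain ⟨hideal, hcube⟩ := pair_equiv_of_basis T a' hI' (u₁ := -u₁) (u₂ := u₂) (d := d)
      (by linear_combination -hu₁') (by linear_combination hu₂') f1' f2'
    have hdisc' : a'.disc = NumberField.discr K := by
      rw [ha', disc_subst, Matrix.det_fin_two_of, hdiscZ]; norm_num
    exact ⟨a', -u₁, u₂, α * -β, hdisc', f1', f2', hd0, mul_ne_zero hα0 (neg_ne_zero.mpr hβ0),
      hideal, hcube⟩

end Surjective

end SymCubic

end Literature.NumberTheory.CubicFields
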